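import Literature.Geometry.Riemannian.ParallelTransport
import Literature.Analysis.ODE.ParametricLinear
import HarnessLib

/-!
# Smooth parallel transport and parallel orthonormal frames along curves, for an arbitrary model
# with corners (Lee 2018, Thm. 4.32; O'Neill 1983, Ch. 3, Prop. 3.19, Lemma 3.20)

`ParallelTransport.lean` and `ParallelTransportSmooth.lean` prove existence, uniqueness and
smoothness of parallel transport along curves for manifolds charted on the model vector space
itself (`[ChartedSpace E M]`, model `𝓘(ℝ, E)`). The one-chart layer they rest on
(`Lorentzian/CoordinateFrames.lean`: the chart formula
`continuousLinearMapAt_covariantDerivAlong_sum_smul` for `D/dt` of a frame combination and the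
`C^k` Christoffel data `exists_contMDiffOn_christoffel`) is written for an arbitrary model with
corners `I : ModelWithCorners ℝ E H`, and so is the uniqueness theorem `eq_of_isParallelAlongOn`
(Riemannian metrics). This file runs the printed argument in that generality, for a covariant
derivative `cov` on `TM` which is locally `C^∞` and compatible with a Riemannian metric `g`, along
a `C^∞` curve `γ : ℝ → M`:

* `continuousLinearMapAt_covariantDerivAlong_symmL_chart` — the parallel-transport form of the
  chart formula: for `W = e₁⁻¹(γ, w)` one has `e₁ (DW/dt) = w' + Γ(γ, U) w` with
  `Γ = connMatrix b Ĉ`, `U` the coordinate velocity (O'Neill 1983, Ch. 3, Prop. 3.18);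
* `exists_isParallelAlongOn_contMDiffAt_chart` — **local existence of a smooth parallel field**
  inside a chart interval: the linear equation `w' = -Γ(γ, U) w` has a `C^∞` coefficient, hence
  `C^∞` solutions (`Literature.Analysis.ODE.exists_contDiffOn_linearODE_param`, Lang 1995,
  Ch. IV §1), which are parallel fields with `C^∞` lift (O'Neill 1983, Ch. 3, Prop. 3.19);
* `exists_isParallelAlongOn_glue_nhds` — gluing two parallel fields agreeing at one parameter
  (uniqueness, `eq_of_isParallelAlongOn`), exporting local agreement with the pieces;
* `exists_isParallelAlongOn_contMDiffAt` — **global existence** on `(a, b)` with `C^∞` lift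
  (Lee 2018, Thm. 4.32, printed proof: supremum of admissible radii, extension in charts around
  `γ(t₀ ± β)`, gluing);
* `exists_parallel_frame_contMDiffAt`, `exists_parallel_orthonormal_frame_smooth` — parallel
  frames with prescribed initial values, `C^∞` lifts and constant Gram matrix (O'Neill 1983,
  Ch. 3, Lemma 3.20: parallel translation is a linear isometry); in particular a parallel
  orthonormal frame along `γ` through any orthonormal frame at `γ t₀`.

Everything is proved; no definitions and no named facts are introduced.

## References

* J. M. Lee, *Introduction to Riemannian Manifolds*, 2nd ed., GTM 176 (2018), Thm. 4.32 and its
  proof (pp. 107–108), Prop. 5.5 (c). [LeeRiemannianManifolds2018]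
* B. O'Neill, *Semi-Riemannian geometry with applications to relativity*, Academic Press 1983,
  Ch. 3, Prop. 3.18, Prop. 3.19 and Lemma 3.20 (pp. 65–66). [ONeill1983]
* S. Lang, *Differential and Riemannian Manifolds*, GTM 160 (1995), Ch. IV §1, Prop. 1.9,
  Thm. 1.16. [Lang1995]
-/

noncomputable section

open Bundle Set Filter Function
open scoped Manifold ContDiff Topology

namespace Literature.Geometry.Riemannian

open Literature.Geometry.Lorentzian Literature.Analysis.ODE

variable {E : Type*} [NormedAddCommGroup E] [NormedSpace ℝ E] [FiniteDimensional ℝ E]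
  {H : Type*} [TopologicalSpace H] {I : ModelWithCorners ℝ E H}
  {M : Type*} [TopologicalSpace M] [ChartedSpace H M] [IsManifold I ∞ M]
  {cov : CovariantDerivative I E (TangentSpace I : M → Type _)}

/-! ### Locality of `D/dt` in the field; frame combinations; the chart formula -/

/-- **Locality of `D/dt` in the field.** The covariant derivatives along `γ` at `t₀` of two
fields along `γ` which agree near `t₀` coincide (the frame formula involves the coefficient
functions only through their germs at `t₀`). [folklore] -/
theorem covariantDerivAlong_congr_of_eventuallyEq_field {γ : ℝ → M}
    {W W' : Π t : ℝ, TangentSpace I (γ t)} {t₀ : ℝ} (h : ∀ᶠ t in 𝓝 t₀, W t = W' t) :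
    covariantDerivAlong cov γ W t₀ = covariantDerivAlong cov γ W' t₀ := by
  have h0 : W t₀ = W' t₀ := h.self_of_nhds
  have hd : ∀ i, deriv (fun t ↦ (trivializationAt E (TangentSpace I) (γ t₀)).localFrame_coeff
      I (Module.finBasis ℝ E) i (γ t) (W t)) t₀ =
      deriv (fun t ↦ (trivializationAt E (TangentSpace I) (γ t₀)).localFrame_coeff
      I (Module.finBasis ℝ E) i (γ t) (W' t)) t₀ := fun i ↦ by
    refine Filter.EventuallyEq.deriv_eq ?_
    filter_upwards [h] with t ht
    rw [ht]
  simp only [covariantDerivAlong_def, covariantDerivAlongFrame, hd, h0]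

/-- **Being parallel is a local property of the field**: if `W` is parallel along `γ` on `s`
and `W'` agrees with `W` near every parameter of `s`, then `W'` is parallel on `s`.
[folklore] -/
theorem isParallelAlongOn_congr_of_eventuallyEq {γ : ℝ → M}
    {W W' : Π t : ℝ, TangentSpace I (γ t)} {s : Set ℝ}
    (h : IsParallelAlongOn cov γ W s) (heq : ∀ t ∈ s, ∀ᶠ t' in 𝓝 t, W t' = W' t') :
    IsParallelAlongOn cov γ W' s := by
  intro t ht
  have hev := heq t ht
  refine ⟨?_, ?_⟩
  · refine (h t ht).1.congr_of_eventuallyEq ?_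
    filter_upwards [hev] with t' ht'
    change (TotalSpace.mk' E (γ t') (W' t') : TangentBundle I M) =
      TotalSpace.mk' E (γ t') (W t')
    rw [ht']
  · rw [← covariantDerivAlong_congr_of_eventuallyEq_field hev]
    exact (h t ht).2

omit [FiniteDimensional ℝ E] in
/-- A frame combination with coefficient vector `w`: `e₁⁻¹(y, w) = ∑ᵢ wⁱ sᵢ(y)` on the chart
domain of `x₁`, `sᵢ` the local frame of the trivialisation `e₁` of `TM` at `x₁`. [folklore] -/
theorem symmL_trivializationAt_eq_sum_localFrame {ι : Type*} [Fintype ι]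
    (b : Module.Basis ι ℝ E) {x₁ y : M} (hy : y ∈ (chartAt H x₁).source) (w : E) :
    (trivializationAt E (TangentSpace I) x₁).symmL ℝ y w =
      ∑ i, b.repr w i • (trivializationAt E (TangentSpace I) x₁).localFrame b i y := by
  have hye : y ∈ (trivializationAt E (TangentSpace I) x₁).baseSet := by simpa using hy
  have hs : ∀ i, (trivializationAt E (TangentSpace I) x₁).localFrame b i y =
      (trivializationAt E (TangentSpace I) x₁).symmL ℝ y (b i) := fun i ↦ by
    rw [Trivialization.symmL_apply _ hye, Trivialization.localFrame_apply_of_mem_baseSet _ _ hye]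
    simp only [Trivialization.basisAt, Module.Basis.map_apply,
      Trivialization.linearEquivAt_symm_apply]
  simp only [hs, ← map_smul]
  rw [← map_sum, b.sum_repr]

/-- **The parallel-transport form of the chart formula** (O'Neill 1983, Ch. 3, Prop. 3.18 and
the equation of the proof of Prop. 3.19). Let the maps `Ĉᵢ` read `w ↦ ∇_w sᵢ` in the
trivialisation `e₁` at `x₁` on `N` (Christoffel data, `exists_contMDiffOn_christoffel`). For a
curve `γ` differentiable at `t` with `γ t ∈ N` and a differentiable coefficient vector
`w : ℝ → E`, the field `W = e₁⁻¹(γ, w)` along `γ` has `e₁ (DW/dt) = w' + Γ(γ t, U) (w t)`,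
`Γ = connMatrix b Ĉ`, `U = e₁ γ'(t)`; so `W` is parallel at `t` iff `w' = -Γ(γ, U) w` there.
[cite: ONeill1983, Ch. 3, Prop. 3.18] -/
theorem continuousLinearMapAt_covariantDerivAlong_symmL_chart {ι : Type*} [Fintype ι]
    (b : Module.Basis ι ℝ E) {x₁ : M} {N : Set M} (hN : N ⊆ (chartAt H x₁).source)
    (Ĉ : ι → M → (E →L[ℝ] E))
    (hĈ : ∀ y ∈ N, ∀ (i) (w : TangentSpace I y),
      Ĉ i y ((trivializationAt E (TangentSpace I) x₁).continuousLinearMapAt ℝ y w) =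
        (trivializationAt E (TangentSpace I) x₁
          ⟨y, cov ((trivializationAt E (TangentSpace I) x₁).localFrame b i) y w⟩).2)
    {γ : ℝ → M} {t : ℝ} (ht : γ t ∈ N) (hγ : MDifferentiableAt 𝓘(ℝ, ℝ) I γ t)
    {w : ℝ → E} (hw : DifferentiableAt ℝ w t) :
    (trivializationAt E (TangentSpace I) x₁).continuousLinearMapAt ℝ (γ t)
        (covariantDerivAlong cov γ
          (fun t' ↦ (trivializationAt E (TangentSpace I) x₁).symmL ℝ (γ t') (w t')) t) =
      deriv w t + connMatrix b Ĉ (γ t)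
        ((trivializationAt E (TangentSpace I) x₁ ⟨γ t, velocity I γ t⟩).2) (w t) := by
  -- near `t` the field is the frame combination with coefficients `cⁱ = (w ·)ⁱ`
  have hγe : ∀ᶠ t' in 𝓝 t, γ t' ∈ (chartAt H x₁).source :=
    hγ.continuousAt.preimage_mem_nhds ((chartAt H x₁).open_source.mem_nhds (hN ht))
  have heq : ∀ᶠ t' in 𝓝 t,
      (trivializationAt E (TangentSpace I) x₁).symmL ℝ (γ t') (w t') =
        ∑ i, (fun i t' ↦ b.repr (w t') i) i t' •
          (trivializationAt E (TangentSpace I) x₁).localFrame b i (γ t') := by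
    filter_upwards [hγe] with t' ht'
    exact symmL_trivializationAt_eq_sum_localFrame b ht' (w t')
  have hc : ∀ i, DifferentiableAt ℝ (fun t' ↦ b.repr (w t') i) t := fun i ↦
    ((b.coord i).toContinuousLinearMap).differentiableAt.comp t hw
  rw [covariantDerivAlong_congr_of_eventuallyEq_field heq,
    continuousLinearMapAt_covariantDerivAlong_sum_smul cov b hN Ĉ hĈ ht hγ hc]
  congr 1
  · -- `∑ (wⁱ)' bᵢ = w'`
    have hd : ∀ i, deriv (fun t' ↦ b.repr (w t') i) t = b.repr (deriv w t) i := fun i ↦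
      (((b.coord i).toContinuousLinearMap).hasFDerivAt.comp_hasDerivAt t hw.hasDerivAt).deriv
    simp only [hd]
    exact b.sum_repr (deriv w t)
  · rw [connMatrix_apply]

omit [FiniteDimensional ℝ E] in
/-- The coordinate expression of a `C^∞` curve in the chart at `x₁` is `C^∞` on every open set
of parameters mapped into the chart domain, and so is the coordinate velocity, which is its
derivative (`hasDerivAt_extChartAt_comp`). [folklore] -/
theorem contDiffOn_extChartAt_comp_of_contMDiff (x₁ : M) {γ : ℝ → M}
    (hγ : ContMDiff 𝓘(ℝ, ℝ) I ∞ γ) {J : Set ℝ} (hJ : IsOpen J)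
    (hγs : ∀ t ∈ J, γ t ∈ (chartAt H x₁).source) :
    ContDiffOn ℝ ∞ (extChartAt I x₁ ∘ γ) J ∧
      ContDiffOn ℝ ∞ (fun t ↦ ((trivializationAt E (TangentSpace I) x₁)
        ⟨γ t, velocity I γ t⟩).2) J ∧
      ∀ t ∈ J, HasDerivAt (extChartAt I x₁ ∘ γ)
        (((trivializationAt E (TangentSpace I) x₁) ⟨γ t, velocity I γ t⟩).2) t := by
  have hX : ContDiffOn ℝ ∞ (extChartAt I x₁ ∘ γ) J := by
    intro t ht
    have h1 : ContMDiffAt 𝓘(ℝ, ℝ) 𝓘(ℝ, E) ∞ (extChartAt I x₁ ∘ γ) t :=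
      (contMDiffAt_extChartAt' (hγs t ht)).comp t (hγ t)
    exact (contMDiffAt_iff_contDiffAt.1 h1).contDiffWithinAt
  have hder : ∀ t ∈ J, HasDerivAt (extChartAt I x₁ ∘ γ)
      (((trivializationAt E (TangentSpace I) x₁) ⟨γ t, velocity I γ t⟩).2) t :=
    fun t ht ↦ hasDerivAt_extChartAt_comp ((hγ t).mdifferentiableAt (by simp)) (hγs t ht)
  refine ⟨hX, ?_, hder⟩
  have hD : ContDiffOn ℝ ∞ (deriv (extChartAt I x₁ ∘ γ)) J :=
    hX.deriv_of_isOpen hJ (le_of_eq (show (∞ : ℕ∞ω) + 1 = ∞ from rfl))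
  exact hD.congr fun t ht ↦ (hder t ht).deriv.symm

/-! ### Local existence of smooth parallel fields (O'Neill 1983, Prop. 3.19; Lang 1995, IV §1) -/

section Local

variable [CompleteSpace E]

/-- **Local existence of a smooth parallel field** (O'Neill 1983, Ch. 3, Prop. 3.19, inside one
chart, with the smoothness of the solution), for an arbitrary model with corners: let `cov` be a
locally `C^∞` covariant derivative on `TM`, `γ` a `C^∞` curve and `[c - T, c + T]` a parameter
interval mapped into the chart domain of `x₁`. For `v ∈ T_{γ c}M` and `0 < T' < T` there is a
field `W` along `γ` with `W c = v`, parallel on `(c - T', c + T')` and with `C^∞` lift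
`t ↦ (γ t, W t) ∈ TM` there. Proof: with the `C^∞` Christoffel data `Ĉᵢ` of the chart
(`exists_contMDiffOn_christoffel`) the parallel-transport equation `w' = -Γ(γ, U) w`,
`Γ = connMatrix b Ĉ` (`continuousLinearMapAt_covariantDerivAlong_symmL_chart`), is linear with
`C^∞` coefficient along the `C^∞` curve, so it has a `C^∞` solution with `w(c) = e₁(v)`
(`Literature.Analysis.ODE.exists_contDiffOn_linearODE_param`, Lang 1995, Ch. IV §1); the field
`W = e₁⁻¹(γ, w)` is parallel and has `C^∞` lift. [cite: ONeill1983, Ch. 3, Prop. 3.19] -/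
theorem exists_isParallelAlongOn_contMDiffAt_chart (hreg : cov.IsLocallyContMDiff ∞) (x₁ : M)
    {γ : ℝ → M} (hγ : ContMDiff 𝓘(ℝ, ℝ) I ∞ γ) {c T : ℝ}
    (hγs : ∀ t ∈ Icc (c - T) (c + T), γ t ∈ (chartAt H x₁).source)
    (v : TangentSpace I (γ c)) {T' : ℝ} (hT'0 : 0 < T') (hT'T : T' < T) :
    ∃ W : Π t : ℝ, TangentSpace I (γ t), W c = v ∧
      IsParallelAlongOn cov γ W (Ioo (c - T') (c + T')) ∧
      ∀ t ∈ Ioo (c - T') (c + T'), ContMDiffAt 𝓘(ℝ, ℝ) I.tangent ∞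
        (fun t' ↦ (TotalSpace.mk' E (γ t') (W t') : TangentBundle I M)) t := by
  set e₁ := trivializationAt E (TangentSpace I : M → Type _) x₁ with he₁
  set b := Module.finBasis ℝ E with hb_def
  -- smooth Christoffel data of the chart at `x₁`
  obtain ⟨Ĉ, hĈ, hĈs⟩ := exists_contMDiffOn_christoffel cov hreg b x₁
  set J : Set ℝ := Ioo (c - T) (c + T) with hJ_def
  have hJ : IsOpen J := isOpen_Ioo
  have hJs : ∀ t ∈ J, γ t ∈ (chartAt H x₁).source := fun t ht ↦ hγs t (Ioo_subset_Icc_self ht)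
  have hbase : ∀ t ∈ J, γ t ∈ e₁.baseSet := fun t ht ↦ by simpa [he₁] using hJs t ht
  -- coordinate expression and coordinate velocity of the curve
  obtain ⟨-, hUs, -⟩ := contDiffOn_extChartAt_comp_of_contMDiff x₁ hγ hJ hJs
  set U : ℝ → E := fun t ↦ (e₁ ⟨γ t, velocity I γ t⟩).2 with hU_def
  -- the coefficient of the parallel-transport equation is `C^∞` on `J`
  set B : ℝ → E →L[ℝ] E := fun t ↦ -connMatrix b Ĉ (γ t) (U t) with hB_def
  have hB : ContDiffOn ℝ ∞ B J := by
    have hCγ : ∀ i, ContDiffOn ℝ ∞ (fun t ↦ Ĉ i (γ t)) J := fun i ↦ by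
      have h1 : ContMDiffOn 𝓘(ℝ, ℝ) 𝓘(ℝ, E →L[ℝ] E) ∞ (Ĉ i ∘ γ) J :=
        (hĈs i).comp (hγ.contMDiffOn (s := J)) fun t ht ↦ hJs t ht
      exact contMDiffOn_iff_contDiffOn.1 h1
    have hterm : ∀ i, ContDiffOn ℝ ∞ (fun t ↦
        ((b.coord i).toContinuousLinearMap).smulRight (Ĉ i (γ t) (U t))) J := fun i ↦
      (ContinuousLinearMap.smulRightL ℝ E E
        ((b.coord i).toContinuousLinearMap)).contDiff.comp_contDiffOn ((hCγ i).clm_apply hUs)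
    have hsum := (ContDiffOn.sum (s := Finset.univ) fun i _ ↦ hterm i).neg
    refine hsum.congr fun t _ ↦ ?_
    simp only [hB_def, connMatrix]
  -- the smooth solution of `w' = B w` with `w(c) = e₁ v` (time origin moved to `c`;
  -- the parameter space of the parametric theorem is a dummy copy of `E`)
  set A : E → ℝ → E →L[ℝ] E := fun _ s ↦ B (c + s) with hA_def
  have hA : ContDiffOn ℝ ∞ (fun q : E × ℝ ↦ A q.1 q.2) ((univ : Set E) ×ˢ Ioo (-T) T) := by
    have h1 : ContDiffOn ℝ ∞ (fun q : E × ℝ ↦ c + q.2) ((univ : Set E) ×ˢ Ioo (-T) T) :=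
      (contDiffOn_const.add contDiffOn_snd)
    refine hB.comp h1 fun q hq ↦ ?_
    obtain ⟨-, hq2⟩ := hq
    exact ⟨by linarith [hq2.1], by linarith [hq2.2]⟩
  set w₀ : E := (e₁ ⟨γ c, v⟩).2 with hw₀
  obtain ⟨u, hu0, hud, huc⟩ := exists_contDiffOn_linearODE_param (P := E) (n := (⊤ : ℕ∞))
    le_top isOpen_univ hT'0 hT'T hA w₀
  set w : ℝ → E := fun t ↦ u 0 (t - c) with hw_def
  have hwd : ∀ t ∈ Ioo (c - T') (c + T'), HasDerivAt w (B t (w t)) t := by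
    intro t ht
    have hs : t - c ∈ Ioo (-T') T' := ⟨by linarith [ht.1], by linarith [ht.2]⟩
    have h := hud 0 (mem_univ _) (t - c) hs
    have h2 := HasDerivAt.comp_sub_const t c h
    simp only [hA_def, add_sub_cancel] at h2
    exact h2
  have hwsmooth : ∀ t ∈ Ioo (c - T') (c + T'), ContDiffAt ℝ ∞ w t := by
    intro t ht
    have hs : t - c ∈ Ioo (-T') T' := ⟨by linarith [ht.1], by linarith [ht.2]⟩
    have h1 : ContDiffAt ℝ ∞ (fun q : E × ℝ ↦ u q.1 q.2) ((0 : E), t - c) :=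
      huc.contDiffAt ((isOpen_univ.prod isOpen_Ioo).mem_nhds ⟨mem_univ _, hs⟩)
    have h2 : ContDiffAt ℝ ∞ (fun t' : ℝ ↦ (((0 : E), t' - c) : E × ℝ)) t :=
      contDiffAt_const.prodMk (contDiffAt_id.sub contDiffAt_const)
    have h3 : ContDiffAt ℝ ∞
        ((fun q : E × ℝ ↦ u q.1 q.2) ∘ (fun t' : ℝ ↦ (((0 : E), t' - c) : E × ℝ))) t :=
      h1.comp t h2
    exact h3
  -- the field `W = e₁⁻¹(γ, w)` has `C^∞` lift on `(c - T', c + T')`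
  set W : Π t : ℝ, TangentSpace I (γ t) := fun t ↦ e₁.symmL ℝ (γ t) (w t) with hW_def
  have hlift : ∀ t ∈ Ioo (c - T') (c + T'), ContMDiffAt 𝓘(ℝ, ℝ) I.tangent ∞
      (fun t' ↦ (TotalSpace.mk' E (γ t') (W t') : TangentBundle I M)) t := by
    intro t ht
    have htJ : t ∈ J := ⟨by linarith [ht.1], by linarith [ht.2]⟩
    have hsource : (TotalSpace.mk' E (γ t) (W t) : TangentBundle I M) ∈ e₁.source := by
      rw [Trivialization.mem_source]; exact hbase t htJ
    rw [show (I.tangent : ModelWithCorners ℝ (E × E) (ModelProd H E)) = I.prod 𝓘(ℝ, E) from rfl]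
    refine (e₁.contMDiffAt_iff (f := fun t' ↦ (TotalSpace.mk' E (γ t') (W t') :
      TangentBundle I M)) hsource).2 ⟨hγ t, ?_⟩
    -- the fibre coordinate is `w` near `t`
    have hev : (fun t' ↦ (e₁ (TotalSpace.mk' E (γ t') (W t') : TangentBundle I M)).2) =ᶠ[𝓝 t]
        w := by
      have hJt : ∀ᶠ t' in 𝓝 t, γ t' ∈ e₁.baseSet :=
        (hγ.continuous.continuousAt).preimage_mem_nhds
          (e₁.open_baseSet.mem_nhds (hbase t htJ))
      filter_upwards [hJt] with t' ht'
      show (e₁ ⟨γ t', e₁.symmL ℝ (γ t') (w t')⟩).2 = w t'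
      rw [← Trivialization.continuousLinearMapAt_apply_of_mem ℝ _ ht',
        Trivialization.continuousLinearMapAt_symmL _ ht']
    refine ContMDiffAt.congr_of_eventuallyEq ?_ hev
    exact contMDiffAt_iff_contDiffAt.2 (hwsmooth t ht)
  refine ⟨W, ?_, ?_, hlift⟩
  · -- initial value
    have hcJ : c ∈ J := ⟨by linarith, by linarith⟩
    have hw0' : w c = w₀ := by
      simp only [hw_def, sub_self]
      exact hu0 0 (mem_univ _)
    show e₁.symmL ℝ (γ c) (w c) = v
    rw [hw0', hw₀, ← Trivialization.continuousLinearMapAt_apply_of_mem (R := ℝ) (e := e₁)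
      (hb := hbase c hcJ) (y := v)]
    exact Trivialization.symmL_continuousLinearMapAt _ (hbase c hcJ) v
  · -- the equation `e₁ (DW/dt) = w' + Γ w = 0`
    intro t ht
    have htJ : t ∈ J := ⟨by linarith [ht.1], by linarith [ht.2]⟩
    have hwt : HasDerivAt w (B t (w t)) t := hwd t ht
    refine ⟨(hlift t ht).mdifferentiableAt (by simp), ?_⟩
    have hchart := continuousLinearMapAt_covariantDerivAlong_symmL_chart (cov := cov) b
      subset_rfl Ĉ hĈ (hJs t htJ) ((hγ t).mdifferentiableAt (by simp)) hwt.differentiableAt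
    rw [hwt.deriv] at hchart
    have hzero : e₁.continuousLinearMapAt ℝ (γ t) (covariantDerivAlong cov γ W t) = 0 := by
      rw [hW_def, hchart]
      show B t (w t) + connMatrix b Ĉ (γ t) (U t) (w t) = 0
      simp only [hB_def, neg_apply, neg_add_cancel]
    have h := Trivialization.symmL_continuousLinearMapAt e₁ (R := ℝ) (hbase t htJ)
      (covariantDerivAlong cov γ W t)
    rw [hzero, map_zero] at h
    exact h.symm

end Local

/-! ### Gluing and global existence (Lee 2018, Thm. 4.32), Riemannian metrics -/

variable {n : ℕ∞ω} (g : PseudoRiemannianMetric I n E (TangentSpace I : M → Type _))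

/-- **Gluing two parallel fields at a common parameter** (the step "`V = Ṽ` on their common
domain" of the proof of Lee 2018, Thm. 4.32), for a connection compatible with a Riemannian
metric: if `W₁` is parallel on `(a₁, b₁)`, `W₂` on `(a₂, b₂)`, `t₁` lies in both intervals and
`W₁ t₁ = W₂ t₁`, then the field equal to `W₁` for `t ≤ t₁` and to `W₂` for `t ≥ t₁` is parallel
on `(a₁, b₂)` (by uniqueness, `eq_of_isParallelAlongOn`, `W₁ = W₂` on the common interval), and it
agrees with `W₁`, resp. `W₂`, near every parameter `< t₁`, resp. `≥ t₁` (so that local properties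
such as smoothness of the lift are inherited).
[cite: LeeRiemannianManifolds2018, Thm. 4.32 (proof)] -/
theorem exists_isParallelAlongOn_glue_nhds [Fact (1 ≤ n)] (hg : g.IsRiemannian)
    (hcov : g.IsCompatible cov) {γ : ℝ → M}
    {W₁ W₂ : Π t : ℝ, TangentSpace I (γ t)} {a₁ b₁ a₂ b₂ t₁ : ℝ}
    (h₁ : IsParallelAlongOn cov γ W₁ (Ioo a₁ b₁)) (h₂ : IsParallelAlongOn cov γ W₂ (Ioo a₂ b₂))
    (ht₁ : t₁ ∈ Ioo a₁ b₁) (ht₂ : t₁ ∈ Ioo a₂ b₂) (heq : W₁ t₁ = W₂ t₁) :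
    ∃ W : Π t : ℝ, TangentSpace I (γ t), (∀ t ≤ t₁, W t = W₁ t) ∧
      (∀ t, t₁ ≤ t → W t = W₂ t) ∧ IsParallelAlongOn cov γ W (Ioo a₁ b₂) ∧
      (∀ t < t₁, ∀ᶠ t' in 𝓝 t, W t' = W₁ t') ∧ (∀ t, t₁ ≤ t → ∀ᶠ t' in 𝓝 t, W t' = W₂ t') := by
  classical
  -- `W₁ = W₂` on the common interval
  have hcommon : t₁ ∈ Ioo (max a₁ a₂) (min b₁ b₂) := ⟨max_lt ht₁.1 ht₂.1, lt_min ht₁.2 ht₂.2⟩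
  have hagree : ∀ t ∈ Ioo (max a₁ a₂) (min b₁ b₂), W₁ t = W₂ t := fun t ht ↦
    eq_of_isParallelAlongOn g hg hcov ordConnected_Ioo
      (h₁.mono (Ioo_subset_Ioo (le_max_left _ _) (min_le_left _ _)))
      (h₂.mono (Ioo_subset_Ioo (le_max_right _ _) (min_le_right _ _))) hcommon heq ht
  set W : Π t : ℝ, TangentSpace I (γ t) := fun t ↦ if t ≤ t₁ then W₁ t else W₂ t with hW
  have hle : ∀ t ≤ t₁, W t = W₁ t := fun t ht ↦ if_pos ht
  have hge : ∀ t, t₁ ≤ t → W t = W₂ t := by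
    intro t ht
    rcases ht.lt_or_eq with hlt | heq'
    · exact if_neg (not_le.2 hlt)
    · subst heq'
      rw [hle t₁ le_rfl]
      exact heq
  -- local agreement
  have hloc₁ : ∀ t < t₁, ∀ᶠ t' in 𝓝 t, W t' = W₁ t' := fun t ht ↦ by
    filter_upwards [Iio_mem_nhds ht] with t'' ht''
    exact hle t'' (le_of_lt ht'')
  have hloc₂ : ∀ t, t₁ ≤ t → ∀ᶠ t' in 𝓝 t, W t' = W₂ t' := by
    intro t ht
    rcases ht.lt_or_eq with hgt | heqt
    · filter_upwards [Ioi_mem_nhds hgt] with t'' ht''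
      exact hge t'' (le_of_lt ht'')
    · subst heqt
      filter_upwards [Ioo_mem_nhds hcommon.1 hcommon.2] with t'' ht''
      by_cases h'' : t'' ≤ t₁
      · rw [hle t'' h'']
        exact hagree t'' ht''
      · exact if_neg h''
  refine ⟨W, hle, hge, ?_, hloc₁, hloc₂⟩
  intro t ht
  by_cases hlt : t < t₁
  · have hparl : IsParallelAlongOn cov γ W (Ioo a₁ t₁) :=
      isParallelAlongOn_congr_of_eventuallyEq (h₁.mono (Ioo_subset_Ioo_right ht₁.2.le))
        fun t' ht' ↦ by
          filter_upwards [hloc₁ t' ht'.2] with t'' ht'' using ht''.symm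
    exact hparl t ⟨ht.1, hlt⟩
  · have hparr : IsParallelAlongOn cov γ W (Ico t₁ b₂) :=
      isParallelAlongOn_congr_of_eventuallyEq (h₂.mono (Ico_subset_Ioo_left ht₂.1))
        fun t' ht' ↦ by
          filter_upwards [hloc₂ t' ht'.1] with t'' ht'' using ht''.symm
    exact hparr t ⟨not_lt.1 hlt, ht.2⟩

section Global

variable [CompleteSpace E]

/-- **Existence of smooth parallel transport along a whole curve** (Lee 2018, Thm. 4.32;
O'Neill 1983, Ch. 3, Prop. 3.19), for an arbitrary model with corners: let `cov` be a locally
`C^∞` covariant derivative on `TM` compatible with a Riemannian metric `g`, and `γ : ℝ → M` a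
`C^∞` curve. For `a < t₀ < b` and `v ∈ T_{γ t₀}M` there is a field `W` along `γ` with
`W t₀ = v`, parallel on `(a, b)`, whose lift `t ↦ (γ t, W t) ∈ TM` is `C^∞` on `(a, b)`.
Proof as printed (Lee, p. 108): let `β` be the supremum of the radii `r` such that a smooth
parallel field with `W t₀ = v` exists on `(t₀ - r, t₀ + r)`; it is positive by the one-chart
existence theorem (`exists_isParallelAlongOn_contMDiffAt_chart`) near `t₀`; if it fell short,
transporting in charts around `γ(t₀ ± β)` from the parameters `t₀ ± (β - δ/2)` and gluing by
uniqueness (`exists_isParallelAlongOn_glue_nhds`) would extend the field past `β`.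
[cite: LeeRiemannianManifolds2018, Thm. 4.32] [cite: ONeill1983, Ch. 3, Prop. 3.19] -/
theorem exists_isParallelAlongOn_contMDiffAt [Fact (1 ≤ n)] (hg : g.IsRiemannian)
    (hcov : g.IsCompatible cov) (hreg : cov.IsLocallyContMDiff ∞) {γ : ℝ → M}
    (hγ : ContMDiff 𝓘(ℝ, ℝ) I ∞ γ) {a b t₀ : ℝ} (ht₀ : t₀ ∈ Ioo a b)
    (v : TangentSpace I (γ t₀)) :
    ∃ W : Π t : ℝ, TangentSpace I (γ t), W t₀ = v ∧
      IsParallelAlongOn cov γ W (Ioo a b) ∧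
      ∀ t ∈ Ioo a b, ContMDiffAt 𝓘(ℝ, ℝ) I.tangent ∞
        (fun t' ↦ (TotalSpace.mk' E (γ t') (W t') : TangentBundle I M)) t := by
  have hγd : ∀ t, MDifferentiableAt 𝓘(ℝ, ℝ) I γ t := fun t ↦ (hγ t).mdifferentiableAt (by simp)
  -- charts along the curve: `γ [s - 4δ, s + 4δ]` inside the chart domain of `γ s`
  have hchart : ∀ s : ℝ, ∃ δ > 0, ∀ t ∈ Icc (s - 4 * δ) (s + 4 * δ),
      γ t ∈ (chartAt H (γ s)).source := by
    intro s
    have hmem : γ ⁻¹' (chartAt H (γ s)).source ∈ 𝓝 s :=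
      (hγd s).continuousAt.preimage_mem_nhds
        ((chartAt H (γ s)).open_source.mem_nhds (mem_chart_source H (γ s)))
    obtain ⟨ε, hε, hball⟩ := Metric.mem_nhds_iff.1 hmem
    refine ⟨ε / 8, by positivity, fun t ht ↦ hball ?_⟩
    rw [Metric.mem_ball, Real.dist_eq, abs_lt]
    constructor <;> linarith [ht.1, ht.2]
  -- smooth local transport from any parameter of `[s - δ, s + δ]`, radius `3δ/2`
  have hlocal : ∀ (s δ : ℝ), 0 < δ → (∀ t ∈ Icc (s - 4 * δ) (s + 4 * δ),
      γ t ∈ (chartAt H (γ s)).source) →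
      ∀ {t₁ : ℝ}, t₁ ∈ Icc (s - δ) (s + δ) → ∀ w : TangentSpace I (γ t₁),
      ∃ W : Π t : ℝ, TangentSpace I (γ t), W t₁ = w ∧
        IsParallelAlongOn cov γ W (Ioo (t₁ - 3 * δ / 2) (t₁ + 3 * δ / 2)) ∧
        ∀ t ∈ Ioo (t₁ - 3 * δ / 2) (t₁ + 3 * δ / 2), ContMDiffAt 𝓘(ℝ, ℝ) I.tangent ∞
          (fun t' ↦ (TotalSpace.mk' E (γ t') (W t') : TangentBundle I M)) t := by
    intro s δ hδ hsrc t₁ ht₁ w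
    exact exists_isParallelAlongOn_contMDiffAt_chart hreg (γ s) hγ (c := t₁) (T := 2 * δ)
      (fun t ht ↦ hsrc t ⟨by linarith [ht.1, ht₁.1], by linarith [ht.2, ht₁.2]⟩) w
      (T' := 3 * δ / 2) (by positivity) (by linarith)
  -- the set of admissible radii and its supremum
  set R := max (t₀ - a) (b - t₀) with hR
  have hR0 : 0 < R := lt_max_of_lt_left (by linarith [ht₀.1])
  set S : Set ℝ := {r | 0 < r ∧ r ≤ R ∧ ∃ W : Π t : ℝ, TangentSpace I (γ t), W t₀ = v ∧
    IsParallelAlongOn cov γ W (Ioo (t₀ - r) (t₀ + r)) ∧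
    ∀ t ∈ Ioo (t₀ - r) (t₀ + r), ContMDiffAt 𝓘(ℝ, ℝ) I.tangent ∞
      (fun t' ↦ (TotalSpace.mk' E (γ t') (W t') : TangentBundle I M)) t} with hS
  have hbdd : BddAbove S := ⟨R, fun r hr ↦ hr.2.1⟩
  -- `S` is nonempty: transport inside the chart at `γ t₀`
  obtain ⟨δ₀, hδ₀, hsrc₀⟩ := hchart t₀
  obtain ⟨W₀, hW₀, hW₀p, hW₀s⟩ := hlocal t₀ δ₀ hδ₀ hsrc₀ (t₁ := t₀) ⟨by linarith, by linarith⟩ v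
  have hr₀ : min δ₀ R ∈ S := by
    refine ⟨lt_min hδ₀ hR0, min_le_right _ _, W₀, hW₀, hW₀p.mono (Ioo_subset_Ioo ?_ ?_),
      fun t ht ↦ hW₀s t ⟨?_, ?_⟩⟩
    · linarith [min_le_left δ₀ R]
    · linarith [min_le_left δ₀ R]
    · linarith [min_le_left δ₀ R, ht.1]
    · linarith [min_le_left δ₀ R, ht.2]
  have hne : S.Nonempty := ⟨_, hr₀⟩
  set β := sSup S with hβ
  have hβpos : 0 < β := lt_of_lt_of_le (lt_min hδ₀ hR0) (le_csSup hbdd hr₀)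
  have hβR : β ≤ R := csSup_le hne fun r hr ↦ hr.2.1
  -- the key step: `R ∈ S`
  have hRS : R ∈ S := by
    obtain ⟨δ₁, hδ₁, hsrc₁⟩ := hchart (t₀ + β)
    obtain ⟨δ₂, hδ₂, hsrc₂⟩ := hchart (t₀ - β)
    set δ := min (min δ₁ δ₂) β with hδ
    have hδpos : 0 < δ := lt_min (lt_min hδ₁ hδ₂) hβpos
    have hδ₁' : δ ≤ δ₁ := (min_le_left _ _).trans (min_le_left _ _)
    have hδ₂' : δ ≤ δ₂ := (min_le_left _ _).trans (min_le_right _ _)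
    have hδβ : δ ≤ β := min_le_right _ _
    -- the charts at `γ (t₀ ± β)` are good for the radius `δ` as well
    have hsrc₁' : ∀ t ∈ Icc (t₀ + β - 4 * δ) (t₀ + β + 4 * δ),
        γ t ∈ (chartAt H (γ (t₀ + β))).source := fun t ht ↦
      hsrc₁ t ⟨by nlinarith [ht.1, hδ₁', hδpos], by nlinarith [ht.2, hδ₁', hδpos]⟩
    have hsrc₂' : ∀ t ∈ Icc (t₀ - β - 4 * δ) (t₀ - β + 4 * δ),
        γ t ∈ (chartAt H (γ (t₀ - β))).source := fun t ht ↦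
      hsrc₂ t ⟨by nlinarith [ht.1, hδ₂', hδpos], by nlinarith [ht.2, hδ₂', hδpos]⟩
    -- an admissible radius `r > β - δ/2`
    obtain ⟨r, hrS, hr⟩ := exists_lt_of_lt_csSup hne (show β - δ / 2 < sSup S by
      rw [← hβ]; linarith)
    have hrβ : r ≤ β := le_csSup hbdd hrS
    obtain ⟨hr0, -, W, hWv, hWp, hWs⟩ := hrS
    -- transport to the right, from `t₀ + β - δ/2`, inside the chart at `γ (t₀ + β)`
    obtain ⟨W₁, hW₁, hW₁p, hW₁s⟩ := hlocal (t₀ + β) δ hδpos hsrc₁' (t₁ := t₀ + β - δ / 2)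
      ⟨by linarith, by linarith⟩ (W (t₀ + β - δ / 2))
    obtain ⟨W', hW'le, -, hW'p, hW'l, hW'r⟩ := exists_isParallelAlongOn_glue_nhds g hg hcov
      hWp hW₁p (t₁ := t₀ + β - δ / 2) ⟨by linarith, by linarith⟩ ⟨by linarith, by linarith⟩
      hW₁.symm
    have hW'v : W' t₀ = v := by rw [hW'le t₀ (by linarith), hWv]
    have hW's : ∀ t ∈ Ioo (t₀ - r) (t₀ + β + δ), ContMDiffAt 𝓘(ℝ, ℝ) I.tangent ∞
        (fun t' ↦ (TotalSpace.mk' E (γ t') (W' t') : TangentBundle I M)) t := by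
      intro t ht
      by_cases hlt : t < t₀ + β - δ / 2
      · have hev := hW'l t hlt
        refine (hWs t ⟨ht.1, by linarith⟩).congr_of_eventuallyEq ?_
        filter_upwards [hev] with t' ht'
        rw [ht']
      · have hev := hW'r t (not_lt.1 hlt)
        refine (hW₁s t ⟨by linarith [not_lt.1 hlt], by linarith [ht.2]⟩).congr_of_eventuallyEq ?_
        filter_upwards [hev] with t' ht'
        rw [ht']
    have hW'p' : IsParallelAlongOn cov γ W' (Ioo (t₀ - r) (t₀ + β + δ)) :=
      hW'p.mono (Ioo_subset_Ioo le_rfl (by linarith))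
    -- transport to the left, from `t₀ - β + δ/2`, inside the chart at `γ (t₀ - β)`
    obtain ⟨W₂, hW₂, hW₂p, hW₂s⟩ := hlocal (t₀ - β) δ hδpos hsrc₂' (t₁ := t₀ - β + δ / 2)
      ⟨by linarith, by linarith⟩ (W' (t₀ - β + δ / 2))
    obtain ⟨W'', -, hW''ge, hW''p, hW''l, hW''r⟩ := exists_isParallelAlongOn_glue_nhds g hg
      hcov hW₂p hW'p' (t₁ := t₀ - β + δ / 2) ⟨by linarith, by linarith⟩
      ⟨by linarith, by linarith⟩ hW₂
    have hW''v : W'' t₀ = v := by rw [hW''ge t₀ (by linarith), hW'v]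
    have hW''s : ∀ t ∈ Ioo (t₀ - β - δ) (t₀ + β + δ), ContMDiffAt 𝓘(ℝ, ℝ) I.tangent ∞
        (fun t' ↦ (TotalSpace.mk' E (γ t') (W'' t') : TangentBundle I M)) t := by
      intro t ht
      by_cases hlt : t < t₀ - β + δ / 2
      · have hev := hW''l t hlt
        refine (hW₂s t ⟨by linarith [ht.1], by linarith⟩).congr_of_eventuallyEq ?_
        filter_upwards [hev] with t' ht'
        rw [ht']
      · have hev := hW''r t (not_lt.1 hlt)
        refine (hW's t ⟨by linarith [not_lt.1 hlt], ht.2⟩).congr_of_eventuallyEq ?_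
        filter_upwards [hev] with t' ht'
        rw [ht']
    -- the radius `min (β + δ) R` is admissible, hence `= R`
    have hmem : min (β + δ) R ∈ S := by
      refine ⟨lt_min (by linarith) hR0, min_le_right _ _, W'', hW''v,
        hW''p.mono (Ioo_subset_Ioo ?_ ?_), fun t ht ↦ hW''s t ⟨?_, ?_⟩⟩
      · linarith [min_le_left (β + δ) R]
      · linarith [min_le_left (β + δ) R]
      · linarith [min_le_left (β + δ) R, ht.1]
      · linarith [min_le_left (β + δ) R, ht.2]
    have hle : min (β + δ) R ≤ β := le_csSup hbdd hmem
    by_cases hcase : R ≤ β + δ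
    · rwa [min_eq_right hcase] at hmem
    · exfalso
      rw [min_eq_left (le_of_lt (not_le.1 hcase))] at hle
      linarith
  obtain ⟨-, -, W, hWv, hWp, hWs⟩ := hRS
  refine ⟨W, hWv, hWp.mono (Ioo_subset_Ioo ?_ ?_), fun t ht ↦ hWs t ⟨?_, ?_⟩⟩
  · linarith [le_max_left (t₀ - a) (b - t₀)]
  · linarith [le_max_right (t₀ - a) (b - t₀)]
  · linarith [le_max_left (t₀ - a) (b - t₀), ht.1]
  · linarith [le_max_right (t₀ - a) (b - t₀), ht.2]

/-- **Smooth parallel frames along a whole curve with constant Gram matrix** (Lee 2018,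
Thm. 4.32; O'Neill 1983, Ch. 3, Lemma 3.20, "parallel translation is a linear isometry"), for an
arbitrary model with corners: every family of vectors at `γ t₀` extends to fields along the
`C^∞` curve `γ`, parallel with `C^∞` lifts on `(a, b)`, and `g(eᵢ t, eⱼ t) = g(vᵢ, vⱼ)` for all
`t ∈ (a, b)`. [cite: ONeill1983, Ch. 3, Prop. 3.19 and Lemma 3.20]
[cite: LeeRiemannianManifolds2018, Thm. 4.32] -/
theorem exists_parallel_frame_contMDiffAt [Fact (1 ≤ n)] (hg : g.IsRiemannian)
    (hcov : g.IsCompatible cov) (hreg : cov.IsLocallyContMDiff ∞) {γ : ℝ → M}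
    (hγ : ContMDiff 𝓘(ℝ, ℝ) I ∞ γ) {a b t₀ : ℝ} (ht₀ : t₀ ∈ Ioo a b) {ι : Type*}
    (v : ι → TangentSpace I (γ t₀)) :
    ∃ e : ι → Π t : ℝ, TangentSpace I (γ t), (∀ i, e i t₀ = v i) ∧
      (∀ i, IsParallelAlongOn cov γ (e i) (Ioo a b)) ∧
      (∀ i, ∀ t ∈ Ioo a b, ContMDiffAt 𝓘(ℝ, ℝ) I.tangent ∞
        (fun t' ↦ (TotalSpace.mk' E (γ t') (e i t') : TangentBundle I M)) t) ∧
      ∀ t ∈ Ioo a b, ∀ i j, g.val (γ t) (e i t) (e j t) = g.val (γ t₀) (v i) (v j) := by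
  choose e he0 hep hes using fun i ↦ exists_isParallelAlongOn_contMDiffAt g hg hcov hreg hγ ht₀ (v i)
  refine ⟨e, he0, hep, hes, fun t ht i j ↦ ?_⟩
  set a' := min t₀ t with ha'
  set b' := max t₀ t with hb'
  have hsub : Icc a' b' ⊆ Ioo a b := fun s hs ↦
    ⟨lt_of_lt_of_le (lt_min ht₀.1 ht.1) hs.1, lt_of_le_of_lt hs.2 (max_lt ht₀.2 ht.2)⟩
  have hmono : ∀ k, IsParallelAlongOn cov γ (e k) (Icc a' b') := fun k s hs ↦ hep k s (hsub hs)
  have hta : t ∈ Icc a' b' := ⟨min_le_right _ _, le_max_right _ _⟩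
  have ht₀a : t₀ ∈ Icc a' b' := ⟨min_le_left _ _, le_max_left _ _⟩
  rw [val_apply_eq_of_isParallelAlongOn g hcov (hmono i) (hmono j) hta,
    ← val_apply_eq_of_isParallelAlongOn g hcov (hmono i) (hmono j) ht₀a, he0, he0]

/-- **A parallel orthonormal frame along a curve through a given orthonormal frame** (O'Neill
1983, Ch. 3, Lemma 3.20; Lee 2018, Prop. 5.5 (c) / Thm. 4.32), for an arbitrary model with
corners: an orthonormal family `(vᵢ)` at `γ t₀` extends to fields `eᵢ` along the `C^∞` curve
`γ`, parallel with `C^∞` lifts on `(a, b)` and orthonormal at every `t ∈ (a, b)`.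
[cite: ONeill1983, Ch. 3, Lemma 3.20] [cite: LeeRiemannianManifolds2018, Thm. 4.32] -/
theorem exists_parallel_orthonormal_frame_smooth [Fact (1 ≤ n)] (hg : g.IsRiemannian)
    (hcov : g.IsCompatible cov) (hreg : cov.IsLocallyContMDiff ∞) {γ : ℝ → M}
    (hγ : ContMDiff 𝓘(ℝ, ℝ) I ∞ γ) {a b t₀ : ℝ} (ht₀ : t₀ ∈ Ioo a b) {ι : Type*} [DecidableEq ι]
    (v : ι → TangentSpace I (γ t₀))
    (hv : ∀ i j, g.val (γ t₀) (v i) (v j) = if i = j then 1 else 0) :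
    ∃ e : ι → Π t : ℝ, TangentSpace I (γ t), (∀ i, e i t₀ = v i) ∧
      (∀ i, IsParallelAlongOn cov γ (e i) (Ioo a b)) ∧
      (∀ i, ∀ t ∈ Ioo a b, ContMDiffAt 𝓘(ℝ, ℝ) I.tangent ∞
        (fun t' ↦ (TotalSpace.mk' E (γ t') (e i t') : TangentBundle I M)) t) ∧
      ∀ t ∈ Ioo a b, ∀ i j, g.val (γ t) (e i t) (e j t) = if i = j then 1 else 0 := by
  obtain ⟨e, he0, hep, hes, hgram⟩ := exists_parallel_frame_contMDiffAt g hg hcov hreg hγ ht₀ v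
  exact ⟨e, he0, hep, hes, fun t ht i j ↦ (hgram t ht i j).trans (hv i j)⟩

end Global

end Literature.Geometry.Riemannian

end
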